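import Summits.ABC.IUTFork.Joshi.LocalPeriodRingsModelTower
import Summits.ABC.IUTFork.Joshi.LogLinkFrobeniusTransport
import HarnessLib

/-!
# The joint §5–§6 vacuity model WITH A NON-TRIVIAL LOG-LINK (10.7.1): `Model.towerDatum` with `η_y(S) := 1`

Test-side support file of the abc-iut cell, branch E (rung LADDER-ABC:A2.E; seat abc-iut-E-t40, typer-side second reader of
`Joshi/LocalPeriodRingsModelTower.lean` p438686). PURPOSE. E-t9's joint model of E-t3's §2 signature `PeriodRingDatum` ([J-IIp]
arXiv:2303.01662v3) and of the [J-III] §5 tower `ATS3.PeriodRingTower` / `BEDatum` (arXiv:2401.13508v4 §5.1–§5.2, p429989) is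
VOID on the log-link side: its residue maps kill `S`, so `η_y ≡ 0` on `B^{φ=p} = A·S` and the log-link (10.7.1) `logLinkRel y₁ y₂`
([J-IIp] p. 32 l. 1–6; `Joshi/LogLinkColumn.lean` p429867) is `{(0,0)}` (reader's sheet `HOME/plan/E/t40/READ-p438686.md` INFO I2,
kernel fact `eta_eq_zero_of_frob`): no landed model exhibited «§5 tower ∧ §2 signature ∧ a NON-trivial log-link». This file
gives one by the SINGLE change `η_y(S) := 1` in E-t9's dictionary — every other field of `Model.towerDatum` is kept (`[x]` is
constant in `S`, so the `η`-axioms (A1)/(A2) and `T_y ⊆ ker η_y` are re-proved from E-t9's own lemmas) — and carries E-t9's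
tower and `BEDatum` over field by field (`PeriodRingTower` never mentions `η`). AT THIS MODEL (kernel): `S ∈ B^{φ=p}`,
`η_y(S) = 1`; `logLinkRel y₁ y₂ ∋ (c, c)` for every `c ∈ Q̄_p` and `∋ (Χ(q/e_{y₁}), Χ(q/e_{y₂}))`, so between the points `1` and
`2` it relates elements of DIFFERENT absolute value; E-t3's typed middle-row form of [J-IIp] Thm. 10.15.1 (3)
`NoCommutingFieldIso y` HOLDS at every point (a commuting `f` would need `f 1 = p`), hence NO §10.13 Frobenius transport exists
at any point (E-t7's `not_noCommutingFieldIso_of_transport`, p430819) — dual to E-t52's column models p434703 / p439129, where a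
transport exists and the typed (3) fails. HONEST SCOPE (declared): the model is LOGICAL, not arithmetic (as its parents:
`F = Q̄_p` of characteristic `0`, `ρ`-independent norms with `|S|_ρ = 0`, `B⁺_cris = B⁺_dR`, Galois trivial, `T_y = {0}`; here
moreover `φ(ker η_y) ⊄ ker η_{φ(y)}`); it exhibits joint satisfiability of TYPED axioms, nothing more. No claim about Joshi's
or Mochizuki's mathematics; no side taken on [IUTchIII] Cor. 3.12 or on any author; typed ≠ proved; NO abc claim. [folklore]
-/

noncomputable section

open Polynomial

namespace Summit.ABC.IUTFork.Joshi.Model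

variable (p : ℕ) [hp : Fact p.Prime]

/-! ## 1. The residue maps with `η_y(S) := 1` and the datum -/

/-- The residue map `η_y : B = Q̄_p[ℚ][S] → Q̄_p`, `T^q ↦ Χ(q/e_y)` (E-t9's `etaA`), `S ↦ 1`. [folklore] -/
def etaLogB (y : ℚ) : TowerRing p →+* PadicAlgCl p := eval₂RingHom (etaA p y) 1

/-- `η_y(S) = 1`: the «`p`-adic logarithm» `η_y|_{B^{φ=p}}` (§10.5) is NOT identically zero here. [folklore] -/
theorem etaLogB_X (y : ℚ) : etaLogB p y X = 1 := by
  rw [etaLogB, coe_eval₂RingHom, eval₂_X]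

/-- On Teichmüller representatives (constant in `S`) the new residue map agrees with E-t9's `etaB`. [folklore] -/
theorem etaLogB_teichB (y : ℚ) (x : PadicAlgCl p) : etaLogB p y (teichB p x) = etaB p y (teichB p x) := by
  rw [teichB, etaLogB, etaB, coe_eval₂RingHom, coe_eval₂RingHom, eval₂_C, eval₂_C]

/-- **The model datum**: E-t9's `Model.towerDatum p` with the single change `η_y(S) := 1`. [folklore] -/
def towerLogDatum : PeriodRingDatum (PadicAlgCl p) (TowerRing p) (PadicAlgCl p) ℚ (fun _ => PadicAlgCl p) Unit :=
  { towerDatum p with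
    eta := etaLogB p
    absK_eta_teich := fun y x => by
      show absPow p ((eRat y : ℚ) : ℝ) (eRat_pos_real y) (etaLogB p y (teichB p x)) = absOne p x
      rw [etaLogB_teichB, absPow_apply, absOne_apply]
      exact norm_etaB_teichB_rpow p y x
    exists_teich_lift := fun y ξ _ => (exists_etaB_teichB_eq p y ξ).imp fun x hx => by
      show etaLogB p y (teichB p x) = ξ
      rw [etaLogB_teichB, hx]
    eta_T := fun y τ hτ => by rw [Set.mem_singleton_iff.1 (show τ ∈ ({0} : Set (TowerRing p)) from hτ), map_zero] }

/-- Read-back: the residue maps ARE `etaLogB`. [folklore] -/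
theorem towerLogDatum_eta (y : ℚ) (f : TowerRing p) : (towerLogDatum p).eta y f = etaLogB p y f := rfl

/-- `B⁺` unfolded: `f ∈ B⁺ ↔ ordNorm (f(S=0)) ≤ 1`, as for `towerDatum`. [folklore] -/
theorem towerLog_mem_Bplus_iff (f : TowerRing p) : f ∈ (towerLogDatum p).Bplus ↔ ordNorm p (f.coeff 0) ≤ 1 := Iff.rfl

/-- `ℚ_p ⊂ B⁺` (§5.2.1), carried over from E-t9's `algebraMap_mem_Bplus`. [folklore] -/
theorem towerLog_algebraMap_mem_Bplus (q : ℚ_[p]) : algebraMap ℚ_[p] (TowerRing p) q ∈ (towerLogDatum p).Bplus :=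
  (towerLog_mem_Bplus_iff p _).2 ((mem_Bplus_iff p _).1 (algebraMap_mem_Bplus p q))

/-! ## 2. The log-link side is NON-trivial -/

/-- Local copy (as in the parents): `0 < ‖p‖ < 1` in `Q̄_p` (`‖p‖ = p⁻¹`). [folklore] -/
private theorem norm_p_pos_lt_one' : 0 < ‖(p : PadicAlgCl p)‖ ∧ ‖(p : PadicAlgCl p)‖ < 1 := by
  have h1 : (1 : ℝ) < p := by exact_mod_cast hp.out.one_lt
  have e : ‖(p : PadicAlgCl p)‖ = (p : ℝ)⁻¹ := by
    rw [← map_natCast (algebraMap ℚ_[p] (PadicAlgCl p)), ← PadicAlgCl.coe_eq]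
    show ‖((p : ℚ_[p]) : PadicAlgCl p)‖ = _
    rw [PadicAlgCl.norm_extends, Padic.norm_p]
  rw [e]
  exact ⟨inv_pos.2 (lt_trans one_pos h1), inv_lt_one_of_one_lt₀ h1⟩

/-- `a·S ∈ B^{φ=p}` for every `a ∈ A`: `φ(a·S) = a·p·S`. [folklore] -/
theorem C_mul_X_mem_Bphi (a : ExpAlg p) : C a * X ∈ (towerLogDatum p).Bphi := by
  show frobEquivA p (C a * X) = (p : TowerRing p) * (C a * X)
  rw [map_mul, frobEquivA_X, frobEquivA_apply, aeval_C, Polynomial.algebraMap_eq]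
  ring

/-- In particular `S ∈ B^{φ=p}` (`φ(S) = p·S`, [FF18] 10.1.1 as used in §5.2). [folklore] -/
theorem X_mem_Bphi : (X : TowerRing p) ∈ (towerLogDatum p).Bphi := by
  simpa only [map_one, one_mul] using C_mul_X_mem_Bphi p 1

/-- `η_y(a·S) = etaA_y(a)`. [folklore] -/
theorem eta_C_mul_X (y : ℚ) (a : ExpAlg p) : (towerLogDatum p).eta y (C a * X) = etaA p y a := by
  rw [towerLogDatum_eta, map_mul, etaLogB_X, mul_one, etaLogB, coe_eval₂RingHom, eval₂_C]

/-- **The log-link (10.7.1) is non-trivial**: `(c, c) ∈ logLinkRel y₁ y₂` for every `c ∈ Q̄_p` (`b = (T⁰·c)·S`). [folklore] -/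
theorem const_pair_mem_logLinkRel (y₁ y₂ : ℚ) (c : PadicAlgCl p) :
    (c, c) ∈ (towerLogDatum p).logLinkRel y₁ y₂ := by
  refine ⟨C (AddMonoidAlgebra.single 0 c) * X, C_mul_X_mem_Bphi p _, ?_⟩
  rw [eta_C_mul_X, eta_C_mul_X, etaA_single, etaA_single, zero_div, zero_div, ofAdd_zero, map_one, mul_one]

/-- The twisted pairs `(Χ(q/e_{y₁}), Χ(q/e_{y₂})) ∈ logLinkRel y₁ y₂`, witnessed by `b = T^q·S`. [folklore] -/
theorem chi_pair_mem_logLinkRel (y₁ y₂ q : ℚ) :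
    (chi p (Multiplicative.ofAdd (q / eRat y₁)), chi p (Multiplicative.ofAdd (q / eRat y₂))) ∈
      (towerLogDatum p).logLinkRel y₁ y₂ := by
  refine ⟨C (AddMonoidAlgebra.single q 1) * X, C_mul_X_mem_Bphi p _, ?_⟩
  rw [eta_C_mul_X, eta_C_mul_X, etaA_single, etaA_single, one_mul, one_mul]

/-- **The log-link moves valuations**: between the points `1` and `2` (twist exponents `1, 2`) it relates `Χ(2)` to `Χ(1)`,
of absolute values `‖p‖² ≠ ‖p‖` — not inside the diagonal (cf. Thm. 10.20.1 (5), growth of valuations). [folklore] -/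
theorem exists_mem_logLinkRel_norm_ne : ∃ x ∈ (towerLogDatum p).logLinkRel 1 2, ‖x.1‖ ≠ ‖x.2‖ := by
  refine ⟨_, chi_pair_mem_logLinkRel p 1 2 2, ?_⟩
  have h1 : (2 : ℚ) / eRat 1 = 2 := by norm_num [eRat]
  have h2 : (2 : ℚ) / eRat 2 = 1 := by norm_num [eRat]
  dsimp only
  rw [h1, h2, norm_chi, norm_chi, Rat.cast_ofNat, Rat.cast_one]
  exact ((Real.rpow_lt_rpow_left_iff_of_base_lt_one (norm_p_pos_lt_one' p).1 (norm_p_pos_lt_one' p).2).2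
    (by norm_num : (1 : ℝ) < 2)).ne

/-- **[J-IIp] Thm. 10.15.1 (3), E-t3's typed middle-row form `NoCommutingFieldIso y`, HOLDS at every point of this model**: a
commuting `f : K_y ≃+* K_{φ(y)}` has `f(η_y b) = p·η_{φ(y)}(b)` on `B^{φ=p}` (`commuting_iso_apply`); at `b = S`: `1 = p`. [folklore] -/
theorem noCommutingFieldIso (y : ℚ) : (towerLogDatum p).NoCommutingFieldIso y := by
  rintro ⟨f, hf⟩
  have h := (towerLogDatum p).commuting_iso_apply f hf (X_mem_Bphi p)
  rw [towerLogDatum_eta, towerLogDatum_eta, etaLogB_X, etaLogB_X, map_one, mul_one] at h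
  exact (Nat.cast_ne_one.2 hp.out.ne_one) h.symm

/-- **Hence NO §10.13 Frobenius transport exists at any point** (via E-t7's `not_noCommutingFieldIso_of_transport`, p430819):
here `φ(ker η_y) ⊄ ker η_{φ(y)}` (`S − 1 ∈ ker η_y`, `η_{φ(y)}(φ(S − 1)) = p − 1 ≠ 0`). Declared honest scope. [folklore] -/
theorem isEmpty_frobeniusTransport (y : ℚ) : IsEmpty ((towerLogDatum p).FrobeniusTransport y) :=
  ⟨fun T => (towerLogDatum p).not_noCommutingFieldIso_of_transport T (noCommutingFieldIso p y)⟩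

/-! ## 3. E-t9's tower and `BEDatum`, carried over; non-vacuity packaged -/

/-- **THE MODEL TOWER over `towerLogDatum`** ([J-III] §5.1–§5.2): E-t9's carriers `B_dR = K'((S))`, `B⁺_dR = K'⟦S⟧`, `t = S`,
`B⁺_cris = B⁺_dR`, `φ = (S ↦ p·S)`, Galois trivial — field by field as in `Model.towerModel`. [folklore] -/
def towerLogModel : ATS3.PeriodRingTower (towerLogDatum p) p (Omega p) where
  p_eq := rfl
  toBdR := toBdRAlg p
  toBdR_injective := toBdRAlg_injective p
  t := X
  t_ne_zero := Polynomial.X_ne_zero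
  BdRplus := BdRplusΩ p
  t_mem_BdRplus := toBdRAlg_mem_BdRplusΩ p X
  isDVR_BdRplus := isDVR_BdRplusΩ p
  isMaximal_span_t := by rw [mk_toBdR_X_eq]; exact isMaximal_span_psX p
  exists_t_pow_mul_mem := exists_X_pow_mul_mem p
  Bcrisplus := BdRplusΩ p
  Bcris := Bcris p
  image_Bplus_subset_Bcrisplus := by rintro _ ⟨f, -, rfl⟩; exact toBdRAlg_mem_BdRplusΩ p f
  Bcris_eq_adjoin := rfl
  frobB := (frobEquivA p).restrictScalars ℚ_[p]
  frobB_apply _ := rfl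
  frob_t := frobEquivA_X p
  frobCris := frobCris p
  frobCris_toBdR x _ h := by rw [coe_frobCris, Subtype.coe_mk, frobΩ_toBdR]; rfl
  galΩ := 1
  galΩ_toBdR _ _ := rfl

/-- In the model, `B_{ℚ_p} = B ⊔ ℚ_p = B` inside `B_dR`. [folklore] -/
theorem towerLog_BE_bot_eq : (towerLogModel p).BE ⊥ = (toBdRAlg p).range := by
  rw [ATS3.PeriodRingTower.BE, IntermediateField.bot_toSubalgebra, sup_bot_eq]; rfl

/-- The Frobenius of `B_{ℚ_p} = B`, transported from `φ_B` (as E-t9's `frobBE`). [folklore] -/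
def towerLogFrobBE : (towerLogModel p).BE ⊥ ≃ₐ[ℚ_[p]] (towerLogModel p).BE ⊥ :=
  (Subalgebra.equivOfEq _ _ (towerLog_BE_bot_eq p)).trans
    (((rangeEquiv p).symm.trans (((frobEquivA p).restrictScalars ℚ_[p]).trans (rangeEquiv p))).trans
      (Subalgebra.equivOfEq _ _ (towerLog_BE_bot_eq p).symm))

/-- **THE MODEL `BEDatum` over `towerLogDatum`**: `E = E_0 = ℚ_p`. [folklore] -/
def towerLogBEDatum : (towerLogModel p).BEDatum where
  E := ⊥
  finiteDimensional := inferInstance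
  E0 := ⊥
  E0_le := le_rfl
  E0_subset_Bplus := by
    intro x hx
    rw [SetLike.mem_coe, IntermediateField.mem_bot] at hx
    obtain ⟨q, rfl⟩ := hx
    exact ⟨algebraMap ℚ_[p] (TowerRing p) q, towerLog_algebraMap_mem_Bplus p q, (toBdRAlg p).commutes q⟩
  frobBE := towerLogFrobBE p
  frobBE_of_mem e he := by
    rw [IntermediateField.mem_bot] at he
    obtain ⟨q, rfl⟩ := he
    have h : (⟨algebraMap ℚ_[p] (Omega p) q, (towerLogModel p).mem_BE_of_mem ⊥ (IntermediateField.mem_bot.2 ⟨q, rfl⟩)⟩ :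
        (towerLogModel p).BE ⊥) = algebraMap ℚ_[p] ((towerLogModel p).BE ⊥) q := Subtype.ext rfl
    rw [h, AlgEquiv.commutes]; rfl

/-- **NON-VACUITY of «§5 tower ∧ §2 signature ∧ a NON-trivial log-link (10.7.1)»** (at `p = 2`): tower and `BEDatum` over
`towerLogDatum 2`, `(1, 1)` in the log-link of the points `1`, `2`, and the typed Thm. 10.15.1 (3) at every point. [folklore] -/
theorem towerLog_carriers_nonempty :
    Nonempty (ATS3.PeriodRingTower (towerLogDatum 2) 2 (Omega 2)) ∧ Nonempty ((towerLogModel 2).BEDatum) ∧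
      ((1 : PadicAlgCl 2), (1 : PadicAlgCl 2)) ∈ (towerLogDatum 2).logLinkRel 1 2 ∧
        ∀ y : ℚ, (towerLogDatum 2).NoCommutingFieldIso y :=
  ⟨⟨towerLogModel 2⟩, ⟨towerLogBEDatum 2⟩, const_pair_mem_logLinkRel 2 1 2 1, noCommutingFieldIso 2⟩

end Summit.ABC.IUTFork.Joshi.Model

end
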